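import Mathlib
import Summits.Parity.BatemanHorn.Theorems.IsogenyRedeiSplitBlockJacobiShell
import HarnessLib

/-!
# Counting the hyperbolic shell (helper toward `stub_poissonReduction`, line
`cofactor-root-discrepancy`, crux `SplitBlockJacobi`, stmt-Parity-11583)

For pairs `(Q, Q′)` with `1 ≤ Q ≤ x` and `X(1−δ′) < QQ′ ≤ X`: `#pairs ≤ δ′X(1 + log x) + x`
(`card_shell_le`, harmonic sum) and `Σ 1/(QQ′) ≤ 2δ′(1 + log x) + 2x/X` (`sum_shell_inv_le`).
-/

noncomputable section

open Finset

namespace Summit.Parity.BatemanHorn.Cruxes.SplitBlockJacobi.CofactorRootDiscrepancy.Poisson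

/-! ### The number of shell pairs and `Σ 1/(QQ′)` over the shell -/

/-- `Σ_{1 ≤ Q ≤ x} 1/Q ≤ 1 + log x` (`x ≥ 1`). -/
theorem sum_Icc_inv_le_log (x : ℕ) :
    ∑ Q ∈ Finset.Icc 1 x, (1 : ℝ) / Q ≤ 1 + Real.log x := by
  have h := harmonic_le_one_add_log x
  rw [harmonic_eq_sum_Icc, Rat.cast_sum] at h
  refine le_trans (le_of_eq ?_) h
  refine Finset.sum_congr rfl fun Q _ => ?_
  push_cast
  rw [one_div]

/-- **Few pairs in the shell**: for `Q ≤ x`-anchored pairs with `X(1−δ′) < QQ′ ≤ X`,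
`#P ≤ δ′ X (1 + log x) + x`. -/
theorem card_shell_le (x : ℕ) {X δ' : ℝ} (hX : 0 < X) (hδ0 : 0 ≤ δ') (hδ1 : δ' ≤ 1)
    (P : Finset (ℕ × ℕ))
    (hP : ∀ q ∈ P, 1 ≤ q.1 ∧ q.1 ≤ x ∧ X * (1 - δ') < ((q.1 * q.2 : ℕ) : ℝ) ∧ ((q.1 * q.2 : ℕ) : ℝ) ≤ X) :
    (P.card : ℝ) ≤ δ' * X * (1 + Real.log x) + x := by
  -- embed into a product and count fibrewise
  set S := (Finset.Icc 1 x ×ˢ Finset.Icc 1 ⌊X⌋₊).filter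
    (fun q : ℕ × ℕ => X * (1 - δ') < ((q.1 * q.2 : ℕ) : ℝ) ∧ ((q.1 * q.2 : ℕ) : ℝ) ≤ X) with hS
  have hsub : P ⊆ S := by
    intro q hq
    obtain ⟨h1, h2, hlo, hhi⟩ := hP q hq
    rw [hS, Finset.mem_filter, Finset.mem_product, Finset.mem_Icc, Finset.mem_Icc]
    refine ⟨⟨⟨h1, h2⟩, ⟨?_, ?_⟩⟩, hlo, hhi⟩
    · by_contra h0
      push Not at h0
      have : q.2 = 0 := by omega
      rw [this, mul_zero, Nat.cast_zero] at hlo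
      nlinarith
    · refine Nat.le_floor ?_
      calc (q.2 : ℝ) ≤ ((q.1 * q.2 : ℕ) : ℝ) := by
            have : q.2 ≤ q.1 * q.2 := Nat.le_mul_of_pos_left _ h1
            exact_mod_cast this
        _ ≤ X := hhi
  have hcardS : (S.card : ℝ) = ∑ Q ∈ Finset.Icc 1 x, ((((Finset.Icc 1 ⌊X⌋₊).filter (fun Q' : ℕ =>
      X * (1 - δ') < ((Q * Q' : ℕ) : ℝ) ∧ ((Q * Q' : ℕ) : ℝ) ≤ X)).card : ℕ) : ℝ) := by
    rw [hS, card_filter_product_eq_sum (Finset.Icc 1 x) (Finset.Icc 1 ⌊X⌋₊)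
      (fun Q Q' => X * (1 - δ') < ((Q * Q' : ℕ) : ℝ) ∧ ((Q * Q' : ℕ) : ℝ) ≤ X), Nat.cast_sum]
  have hfib : ∀ Q ∈ Finset.Icc 1 x, ((((Finset.Icc 1 ⌊X⌋₊).filter (fun Q' : ℕ =>
      X * (1 - δ') < ((Q * Q' : ℕ) : ℝ) ∧ ((Q * Q' : ℕ) : ℝ) ≤ X)).card : ℕ) : ℝ) ≤
      δ' * X / Q + 1 := by
    intro Q hQ
    have hQ1 : (1 : ℝ) ≤ Q := by exact_mod_cast (Finset.mem_Icc.mp hQ).1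
    have hQ0 : (0 : ℝ) < Q := by linarith
    have hsub' : (Finset.Icc 1 ⌊X⌋₊).filter (fun Q' : ℕ =>
        X * (1 - δ') < ((Q * Q' : ℕ) : ℝ) ∧ ((Q * Q' : ℕ) : ℝ) ≤ X) ⊆
        Finset.Ioc ⌊X * (1 - δ') / Q⌋₊ ⌊X / Q⌋₊ := by
      intro Q' hQ'
      rw [Finset.mem_filter] at hQ'
      obtain ⟨-, hlo, hhi⟩ := hQ'
      push_cast at hlo hhi
      rw [Finset.mem_Ioc]
      constructor
      · refine (Nat.floor_lt (by positivity)).mpr ?_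
        rw [div_lt_iff₀ hQ0]; linarith
      · refine Nat.le_floor ?_
        rw [le_div_iff₀ hQ0]; linarith
    have hc := Finset.card_le_card hsub'
    rw [Nat.card_Ioc] at hc
    have hcR : ((((Finset.Icc 1 ⌊X⌋₊).filter (fun Q' : ℕ =>
        X * (1 - δ') < ((Q * Q' : ℕ) : ℝ) ∧ ((Q * Q' : ℕ) : ℝ) ≤ X)).card : ℕ) : ℝ) ≤
        ((⌊X / Q⌋₊ - ⌊X * (1 - δ') / Q⌋₊ : ℕ) : ℝ) := by exact_mod_cast hc
    refine hcR.trans ?_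
    have hfl1 : (⌊X / Q⌋₊ : ℝ) ≤ X / Q := Nat.floor_le (by positivity)
    have hfl2 : X * (1 - δ') / Q - 1 < (⌊X * (1 - δ') / Q⌋₊ : ℝ) := by
      have := Nat.lt_floor_add_one (X * (1 - δ') / Q)
      linarith
    rcases le_or_gt ⌊X * (1 - δ') / Q⌋₊ ⌊X / Q⌋₊ with hle | hgt
    · rw [Nat.cast_sub hle]
      have : X / Q - (X * (1 - δ') / Q - 1) = δ' * X / Q + 1 := by field_simp; ring
      linarith
    · rw [Nat.sub_eq_zero_of_le hgt.le, Nat.cast_zero]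
      positivity
  calc (P.card : ℝ) ≤ S.card := by exact_mod_cast Finset.card_le_card hsub
    _ = _ := hcardS
    _ ≤ ∑ Q ∈ Finset.Icc 1 x, (δ' * X / Q + 1) := Finset.sum_le_sum hfib
    _ = δ' * X * ∑ Q ∈ Finset.Icc 1 x, (1 : ℝ) / Q + x := by
        rw [Finset.sum_add_distrib, Finset.mul_sum]
        simp only [Finset.sum_const, Nat.card_Icc, add_tsub_cancel_right, nsmul_eq_mul, mul_one]
        congr 1
        refine Finset.sum_congr rfl fun Q _ => ?_
        ring
    _ ≤ δ' * X * (1 + Real.log x) + x := by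
        refine add_le_add (mul_le_mul_of_nonneg_left (sum_Icc_inv_le_log x) (by positivity)) le_rfl

/-- **`Σ_{shell} 1/(QQ′) ≤ 2δ′(1 + log x) + 2x/X`** for pairs with `1 ≤ Q ≤ x`,
`X(1−δ′) < QQ′ ≤ X`, `0 ≤ δ′ ≤ 1/2`. -/
theorem sum_shell_inv_le (x : ℕ) (hx : 1 ≤ x) {X δ' : ℝ} (hX : 0 < X) (hδ0 : 0 ≤ δ')
    (hδ2 : δ' ≤ 1 / 2) (P : Finset (ℕ × ℕ))
    (hP : ∀ q ∈ P, 1 ≤ q.1 ∧ q.1 ≤ x ∧ X * (1 - δ') < ((q.1 * q.2 : ℕ) : ℝ) ∧ ((q.1 * q.2 : ℕ) : ℝ) ≤ X) :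
    ∑ q ∈ P, (1 : ℝ) / ((q.1 * q.2 : ℕ) : ℝ) ≤ 2 * δ' * (1 + Real.log x) + 2 * x / X := by
  have hterm : ∀ q ∈ P, (1 : ℝ) / ((q.1 * q.2 : ℕ) : ℝ) ≤ 2 / X := by
    intro q hq
    obtain ⟨-, -, hlo, -⟩ := hP q hq
    have hpos : 0 < X * (1 - δ') := by nlinarith
    rw [div_le_div_iff₀ (hpos.trans hlo) hX]
    nlinarith
  refine (Finset.sum_le_sum hterm).trans ?_
  rw [Finset.sum_const, nsmul_eq_mul]
  have hcard := card_shell_le x hX hδ0 (by linarith) P hP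
  have hlog : 0 ≤ 1 + Real.log x := by
    have : 0 ≤ Real.log x := Real.log_nonneg (by exact_mod_cast hx)
    linarith
  calc (P.card : ℝ) * (2 / X) ≤ (δ' * X * (1 + Real.log x) + x) * (2 / X) :=
        mul_le_mul_of_nonneg_right hcard (by positivity)
    _ = 2 * δ' * (1 + Real.log x) + 2 * x / X := by field_simp

end Summit.Parity.BatemanHorn.Cruxes.SplitBlockJacobi.CofactorRootDiscrepancy.Poisson

namespace Summit.Parity.BatemanHorn.Cruxes.SplitBlockJacobi.CofactorRootDiscrepancy

/-- **Registered stub form** of `Poisson.sum_shell_inv_le`: the identical statement, declared in the crux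
namespace under the name registered on stmt-Parity-11583 (`ledger workitem stub-add`). -/
theorem sum_shell_inv_le :
    ∀ (x : ℕ) (hx : 1 ≤ x) {X δ' : ℝ} (hX : 0 < X) (hδ0 : 0 ≤ δ') (hδ2 : δ' ≤ 1 / 2) (P : Finset (ℕ × ℕ)) (hP : ∀ q ∈ P, 1 ≤ q.1 ∧ q.1 ≤ x ∧ X * (1 - δ') < ((q.1 * q.2 : ℕ) : ℝ) ∧ ((q.1 * q.2 : ℕ) : ℝ) ≤ X), ∑ q ∈ P, (1 : ℝ) / ((q.1 * q.2 : ℕ) : ℝ) ≤ 2 * δ' * (1 + Real.log x) + 2 * x / X :=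
  @Poisson.sum_shell_inv_le

end Summit.Parity.BatemanHorn.Cruxes.SplitBlockJacobi.CofactorRootDiscrepancy

end
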